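import Summits.QuantumFields.YangMills.Theorems.ConvexGribovBodyCovarianceBoundDefsB
import Summits.QuantumFields.YangMills.Theorems.ConvexGribovBodyCovarianceBoundStubSupMeasurable

/-!
# Stub `stub_projSplit` for the crux `CovarianceBound` (stmt-QuantumFields-8780), line `Sketch`

Route `QuantumFields/YangMills/ConvexGribovBody`, crux
`Summit.QuantumFields.YangMills.Theses.ConvexGribovBody.CovarianceBound`, skeleton line `Sketch`
(support slope × response window, `𝔤 / 𝔤^⊥` split, v5). This file proves the registered classical
stub `stub_projSplit` over the line's vocabulary (`…CovarianceBoundDefs.lean`,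
`…CovarianceBoundDefsB.lean`): the orthogonal bookkeeping of the split of the mid-link cosine mode
`Ĉ_j(p)` (`cosMode`) into its `𝔤`-part `P_𝔤 Ĉ` (`lieCosMode`, Shen–Zhu–Zhu's `Re tr(X Yᴴ)`-orthogonal
projection `LatticeRep.lieProj`) and its `𝔤^⊥`-part `Ĉ − P_𝔤 Ĉ` (`perpCosMode`):

1. Pythagoras `‖Ĉ‖²_F = ‖P_𝔤 Ĉ‖²_F + ‖Ĉ − P_𝔤 Ĉ‖²_F` (`froSq X = ⟨X, X⟩`, `⟨P X, X − P X⟩ = 0`);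
2. Borel measurability of the sups over the Coulomb minimisers `supLieCosSq`, `supPerpCosSq`
   (Berge, as for `supCosSq` in `stub_supMeasurable`: closed argmin graph, joint continuity of
   `(U, h) ↦ P_𝔤 Ĉ` — a linear map of a finite-dimensional real space is continuous);
3. the bounds `0 ≤ sup ≤ N (2S+1)⁶` for both parts and `supCosSq ≤ supLieCosSq + supPerpCosSq`.

Helper lemmas live in the sub-namespace `ProjSplit`. No named facts are used.
-/

set_option autoImplicit false

noncomputable section

namespace Summit.QuantumFields.YangMills.Cruxes.CovarianceBound.SupportWindow

open scoped BigOperators Topology Matrix ComplexConjugate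
open Filter Set Function TopologicalSpace MeasureTheory
open Literature.MathematicalPhysics.QuantumFieldTheory

/-! ### Helper lemmas (sub-namespace `ProjSplit`) -/

namespace ProjSplit

variable {G : Type} [Group G] [TopologicalSpace G]

/-- `froSq X = ⟨X, X⟩` for the Hilbert–Schmidt form `Re tr(X Yᴴ)`. [folklore] -/
theorem froSq_eq_hsForm {N : ℕ} (X : Matrix (Fin N) (Fin N) ℂ) : froSq X = hsForm N X X := by
  rw [hsForm_self]; rfl

/-- **Pythagoras** for the orthogonal projection onto `𝔤`:
`‖X‖²_F = ‖P_𝔤 X‖²_F + ‖X − P_𝔤 X‖²_F`. [folklore] -/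
theorem froSq_eq_lieProj_add (r : LatticeRep G) (X : Matrix (Fin r.N) (Fin r.N) ℂ) :
    froSq X = froSq (r.lieProj X) + froSq (X - r.lieProj X) := by
  have h0 : hsForm r.N (r.lieProj X) (X - r.lieProj X) = 0 :=
    r.hsForm_sub_lieProj (r.lieProj_mem X)
  have h0' : hsForm r.N (X - r.lieProj X) (r.lieProj X) = 0 := by rw [hsForm_comm]; exact h0
  simp only [froSq_eq_hsForm]
  conv_lhs => rw [show X = r.lieProj X + (X - r.lieProj X) by abel]
  simp only [map_add, LinearMap.add_apply, h0, h0']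
  ring

/-- `‖P_𝔤 X‖²_F ≤ ‖X‖²_F`. [folklore] -/
theorem froSq_lieProj_le (r : LatticeRep G) (X : Matrix (Fin r.N) (Fin r.N) ℂ) :
    froSq (r.lieProj X) ≤ froSq X := by
  rw [froSq_eq_lieProj_add r X]
  exact le_add_of_nonneg_right (SupMeasurable.froSq_nonneg _)

/-- `‖X − P_𝔤 X‖²_F ≤ ‖X‖²_F`. [folklore] -/
theorem froSq_sub_lieProj_le (r : LatticeRep G) (X : Matrix (Fin r.N) (Fin r.N) ℂ) :
    froSq (X - r.lieProj X) ≤ froSq X := by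
  rw [froSq_eq_lieProj_add r X]
  exact le_add_of_nonneg_left (SupMeasurable.froSq_nonneg _)

/-- `P_𝔤` is continuous (a linear endomorphism of the finite-dimensional real space `M_N(ℂ)`).
[folklore] -/
theorem continuous_lieProj (r : LatticeRep G) : Continuous r.lieProj :=
  LinearMap.continuous_of_finiteDimensional _

/-- The cosine mode is jointly continuous in `(U, h)`. [folklore] -/
theorem continuous_cosMode [IsTopologicalGroup G] (r : LatticeRep G) (S : ℕ)
    (p : Fin 3 → ZMod (2 * S + 1)) (j : Fin 3) :
    Continuous fun q : GaugeConfig 4 (2 * S + 1) G × (Site 4 (2 * S + 1) → G) =>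
      cosMode r S p j q.1 q.2 := by
  unfold cosMode
  exact continuous_finsetSum _ fun y _ => (SupMeasurable.continuous_gluon r S y j).fun_const_smul _

/-- `froSq` of the `𝔤`-part of the cosine mode is jointly continuous in `(U, h)`. [folklore] -/
theorem continuous_froSq_lieCosMode [IsTopologicalGroup G] (r : LatticeRep G) (S : ℕ)
    (p : Fin 3 → ZMod (2 * S + 1)) (j : Fin 3) :
    Continuous fun q : GaugeConfig 4 (2 * S + 1) G × (Site 4 (2 * S + 1) → G) =>
      froSq (lieCosMode r S p j q.1 q.2) := by
  have h := SupMeasurable.continuous_froSq.comp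
    ((continuous_lieProj r).comp (continuous_cosMode r S p j))
  exact h

/-- `froSq` of the `𝔤^⊥`-part of the cosine mode is jointly continuous in `(U, h)`. [folklore] -/
theorem continuous_froSq_perpCosMode [IsTopologicalGroup G] (r : LatticeRep G) (S : ℕ)
    (p : Fin 3 → ZMod (2 * S + 1)) (j : Fin 3) :
    Continuous fun q : GaugeConfig 4 (2 * S + 1) G × (Site 4 (2 * S + 1) → G) =>
      froSq (perpCosMode r S p j q.1 q.2) := by
  have h := SupMeasurable.continuous_froSq.comp
    ((continuous_cosMode r S p j).sub ((continuous_lieProj r).comp (continuous_cosMode r S p j)))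
  exact h

/-- `‖P_𝔤 Ĉ_j(p)‖²_F ≤ N (2S+1)⁶`. [folklore] -/
theorem froSq_lieCosMode_le (r : LatticeRep G) (S : ℕ) (p : Fin 3 → ZMod (2 * S + 1))
    (j : Fin 3) (U : GaugeConfig 4 (2 * S + 1) G) (h : Site 4 (2 * S + 1) → G) :
    froSq (lieCosMode r S p j U h) ≤ r.N * (2 * S + 1 : ℝ) ^ 6 :=
  (froSq_lieProj_le r _).trans (SupMeasurable.froSq_cosMode_le r S p j U h)

/-- `‖Ĉ_j(p) − P_𝔤 Ĉ_j(p)‖²_F ≤ N (2S+1)⁶`. [folklore] -/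
theorem froSq_perpCosMode_le (r : LatticeRep G) (S : ℕ) (p : Fin 3 → ZMod (2 * S + 1))
    (j : Fin 3) (U : GaugeConfig 4 (2 * S + 1) G) (h : Site 4 (2 * S + 1) → G) :
    froSq (perpCosMode r S p j U h) ≤ r.N * (2 * S + 1 : ℝ) ^ 6 :=
  (froSq_sub_lieProj_le r _).trans (SupMeasurable.froSq_cosMode_le r S p j U h)

end ProjSplit

/-! ### The stub -/

open SupMeasurable ProjSplit in
/-- **Stub `stub_projSplit` (classical).** Orthogonal bookkeeping of the `𝔤 / 𝔤^⊥` split of the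
mid-link cosine mode: (1) Pythagoras `‖Ĉ‖²_F = ‖P_𝔤 Ĉ‖²_F + ‖Ĉ − P_𝔤 Ĉ‖²_F` for Shen–Zhu–Zhu's
`Re tr(X Yᴴ)`-orthogonal projection `P_𝔤`; (2) the sups over the Coulomb minimisers of both parts are
Borel measurable (Berge upper semicontinuity: closed argmin graph, joint continuity, second
countability of `G` through the closed embedding `ρ`); (3) `0 ≤ sup ≤ N (2S+1)⁶` for both parts and
`sup ‖Ĉ‖² ≤ sup ‖P_𝔤 Ĉ‖² + sup ‖Ĉ − P_𝔤 Ĉ‖²`. [folklore] -/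
theorem stub_projSplit :
    ∀ (G : Type) [Group G] [TopologicalSpace G] [IsTopologicalGroup G] [CompactSpace G]
      [MeasurableSpace G] [BorelSpace G] (r : LatticeRep G) (S : ℕ) (p : Fin 3 → ZMod (2 * S + 1))
      (j : Fin 3),
      (∀ (U : GaugeConfig 4 (2 * S + 1) G) (h : Site 4 (2 * S + 1) → G),
        froSq (cosMode r S p j U h) = froSq (lieCosMode r S p j U h) + froSq (perpCosMode r S p j U h)) ∧
      Measurable (supLieCosSq r S p j) ∧ Measurable (supPerpCosSq r S p j) ∧
      (∀ U : GaugeConfig 4 (2 * S + 1) G,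
        (∀ h, IsCoulMin r S U h → froSq (cosMode r S p j U h) ≤ r.N * (2 * S + 1 : ℝ) ^ 6) →
        0 ≤ supLieCosSq r S p j U ∧ supLieCosSq r S p j U ≤ r.N * (2 * S + 1 : ℝ) ^ 6 ∧
        0 ≤ supPerpCosSq r S p j U ∧ supPerpCosSq r S p j U ≤ r.N * (2 * S + 1 : ℝ) ^ 6 ∧
        supCosSq r S p j U ≤ supLieCosSq r S p j U + supPerpCosSq r S p j U) := by
  intro G _ _ _ _ _ _ r S p j
  haveI : SecondCountableTopology G :=
    (r.continuous.isClosedEmbedding r.injective).isEmbedding.secondCountableTopology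
  have hsplit : ∀ (U : GaugeConfig 4 (2 * S + 1) G) (h : Site 4 (2 * S + 1) → G),
      froSq (cosMode r S p j U h) =
        froSq (lieCosMode r S p j U h) + froSq (perpCosMode r S p j U h) :=
    fun U h => froSq_eq_lieProj_add r _
  refine ⟨hsplit, ?_, ?_, fun U _ => ?_⟩
  · exact measurable_iSup_subtype_of_isClosed (K := IsCoulMin r S)
      (f := fun U h => froSq (lieCosMode r S p j U h)) (isClosed_isCoulMin r S)
      (exists_isCoulMin r S) (continuous_froSq_lieCosMode r S p j)
      (fun U h => froSq_lieCosMode_le r S p j U h)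
  · exact measurable_iSup_subtype_of_isClosed (K := IsCoulMin r S)
      (f := fun U h => froSq (perpCosMode r S p j U h)) (isClosed_isCoulMin r S)
      (exists_isCoulMin r S) (continuous_froSq_perpCosMode r S p j)
      (fun U h => froSq_perpCosMode_le r S p j U h)
  have hL0 : 0 ≤ supLieCosSq r S p j U := Real.iSup_nonneg fun h => froSq_nonneg _
  have hP0 : 0 ≤ supPerpCosSq r S p j U := Real.iSup_nonneg fun h => froSq_nonneg _
  refine ⟨hL0, Real.iSup_le (fun h => froSq_lieCosMode_le r S p j U h.1) (by positivity), hP0,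
    Real.iSup_le (fun h => froSq_perpCosMode_le r S p j U h.1) (by positivity), ?_⟩
  rcases isEmpty_or_nonempty {h : Site 4 (2 * S + 1) → G // IsCoulMin r S U h} with hE | hN
  · have : supCosSq r S p j U = 0 := Real.iSup_of_isEmpty _
    rw [this]
    exact add_nonneg hL0 hP0
  · refine ciSup_le fun h => ?_
    rw [hsplit U h.1]
    refine add_le_add ?_ ?_
    · exact le_ciSup (f := fun h : {h : Site 4 (2 * S + 1) → G // IsCoulMin r S U h} =>
        froSq (lieCosMode r S p j U h.1))
        ⟨r.N * (2 * S + 1 : ℝ) ^ 6, by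
          rintro _ ⟨h', rfl⟩; exact froSq_lieCosMode_le r S p j U h'.1⟩ h
    · exact le_ciSup (f := fun h : {h : Site 4 (2 * S + 1) → G // IsCoulMin r S U h} =>
        froSq (perpCosMode r S p j U h.1))
        ⟨r.N * (2 * S + 1 : ℝ) ^ 6, by
          rintro _ ⟨h', rfl⟩; exact froSq_perpCosMode_le r S p j U h'.1⟩ h

end Summit.QuantumFields.YangMills.Cruxes.CovarianceBound.SupportWindow

end
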